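import Summits.HodgeConjecture.HodgeConjecture.Theorems.F0P3cStCharTSShellPatternHom    -- ★ (LH6-p04 g2, D3-iii-hom) `coe_central_mul_pow_eq_diagonal` (generic matrix model `E`)
import Literature.NumberTheory.Rogawski1990.LocalNormFibreSurjectiveNonsplit            -- ★ `coe_localNonsplitEquiv_eq_map` (`E₃ g = g.map eval_w`, rfl)
import Literature.NumberTheory.Automorphic.UnitaryGroupBorelInduction                   -- ★ `cmBorelTriple`, `mem_torusU_iff`
import Literature.NumberTheory.Rogawski1990.CMLocalAPacketMembers                       -- ★ `Rogawski1990.qsForm`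
import HarnessLib

/-!
# F0 · P3c · line LH6 «StCharTS» — road (D) «DEEP-FL», (D-c) head glue «HK-SPELLINGS»: one-line bridges between the two level texts of the kernel chain
# (`E₃`-coordinates of ★ p849833 ∕ XIG-St vs `LocalRing`-at-`w` coordinates of ★ p850004 «OCAN-SHELL») and the diagonal reading `hd ∕ h01 ∕ h12` of `b = z·𝓘.aᵐ`
# [Rogawski1990, §12.7 L. 12.7.3 (proof) p. 195; §4.9 p. 55] [PlatonovRapinchuk1994, §5.1]

Cell `pub/hodgecm-mathlib`, crux H413 = `stmt-HodgeConjecture-24833` (lane `--supports … --as helper`), route HCCMUnconditional; seat LH6-p02 (g2); road (D) owner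
LH6-p04 (g3) (offer 2026-09-02T06:58:59Z «HK-SPELLINGS★»).  THEOREMS ONLY, sorry-free, ★-only imports; no definition ∕ instance ∕ notation ∕ named fact.  HONEST LABEL:
HC_CM is proved only modulo the 7 printed citations (2 remaining: hLiu418 = stmt-HodgeConjecture-24832, h413 = stmt-HodgeConjecture-24833) until rung 0 closes; count-neutral
head glue — closes nothing by itself.

THE POINT.  `U(Φ₃)(L⁺_v) ≤ GL₃(∏_{w′ ∣ v} L_{w′})` and, at a non-split `v` (one place `w`, `c·w = w`), the one-place model `E₃ = localNonsplitEquiv … w hw` reads an element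
`k` as the matrix `(k_ij(w))_ij ∈ GL₃(L_w)` (★ `coe_localNonsplitEquiv_eq_map`, `rfl`).  Hence (§1) `|E₃(k)_ij − δ_ij|_w = |(k_ij − δ_ij)(w)|_w` entry by entry, so the
level hypothesis `hK` of ★ p849833 `isLocalDeltaTransfer_of_levi'` ∕ ★ p849876 (in `E₃`-coordinates) and `hKr` of ★ p850004 `exists_normalizedOrbitalIntegral_indicator_shell`
(in `LocalRing`-at-`w` coordinates) are the SAME statement — both directions as `exact`-able implications; (§2) for the shell point `b = z·𝓘.aᵐ ∈ M` with `E₃ z = β·1`,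
`E₃ 𝓘.a = diag(α, 1, (σ_w α)⁻¹)`: `b = diag(d)` in `GL₃(∏ L_{w′})` (★ `mem_torusU_iff`) with `d₀(w) = βαᵐ`, `d₁(w) = β`, `d₂(w) = β(σ_w α)^{−m}` and, for `|β|_w = 1`,
`0 < |α|_w < 1`, `m ≥ 1`, the valuations `|d₀(w)| < |d₁(w)| < |d₂(w)|` — exactly the binders `hd h01 h12` of ★ p850004.

* §1 `coe_localNonsplitEquiv_apply_apply`, `one_apply_apply`, `valued_sub_one_apply_eq`, **`hKr_of_hK`**, **`hK_of_hKr`**.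
* §2 `apply_eq_of_glDiagonal_eq`, `coe_localNonsplitEquiv_central_mul_pow`, **`exists_glDiagonal_shellPoint`**.

## References
* [Rogawski1990] J. D. Rogawski, *Automorphic Representations of Unitary Groups in Three Variables*, Ann. of Math. Stud. 123 (1990), §12.7 Lemma 12.7.3 (proof) p. 195;
  §4.9 p. 55.
* [PlatonovRapinchuk1994] V. Platonov, A. Rapinchuk, *Algebraic Groups and Number Theory*, Academic Press (1994), §5.1 (one-place models of local groups).
-/

set_option autoImplicit false
-- the mandated namespace has the single-problem summit's repeated segment (`HodgeConjecture.HodgeConjecture`)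
set_option linter.dupNamespace false

noncomputable section

open NumberField IsDedekindDomain Matrix
open scoped MatrixGroups
open Literature.NumberTheory Literature.NumberTheory.Automorphic Literature.NumberTheory.Automorphic.UnitaryGroup
open Literature.NumberTheory.GaloisRepresentations
open Literature.NumberTheory.Rogawski1990

namespace Summit.HodgeConjecture.HodgeConjecture.Cruxes.H413.F0P3cStCharTSHKSpellings

variable (L : Type) [Field L] [NumberField L] [IsCMField L] (v : HeightOneSpectrum (𝓞 ↥(maximalRealSubfield L)))
  (w : PlacesOver L v) (hw : IsCMField.complexConj L • w.1 = w.1)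

/-! ## §1 The two level texts: `E₃`-coordinates vs `LocalRing`-at-`w` coordinates -/

/-- `E₃(k)_ij = k_ij(w)` (★ `coe_localNonsplitEquiv_eq_map`, definitional). [cite: PlatonovRapinchuk1994, §5.1] -/
theorem coe_localNonsplitEquiv_apply_apply (k : ↥(unitaryGroupOfForm (conjLocal L (IsCMField.complexConj L) v) (cmLocalForm L 3 v))) (i j : Fin 3) :
    (((localNonsplitEquiv (IsCMField.complexConj L) (qsForm L) (IsCMField.complexConj_ne_one L) w hw k :
        ↥(unitaryGroupOfForm (galAdicCompletionMap (L := L) (IsCMField.complexConj L) hw) (placeForm (qsForm L) w.1))) :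
        GL (Fin 3) (w.1.adicCompletion L)) : Matrix (Fin 3) (Fin 3) (w.1.adicCompletion L)) i j =
      (((k : GL (Fin 3) (LocalRing L v)) : Matrix (Fin 3) (Fin 3) (LocalRing L v)) i j) w := rfl

omit [IsCMField L] hw in
/-- `δ_ij(w) = δ_ij`: the identity matrix over `∏_{w′} L_{w′}` evaluated at `w`. [folklore] -/
theorem one_apply_apply (i j : Fin 3) :
    ((1 : Matrix (Fin 3) (Fin 3) (LocalRing L v)) i j) w = (1 : Matrix (Fin 3) (Fin 3) (w.1.adicCompletion L)) i j := by
  by_cases h : i = j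
  · subst h; rw [Matrix.one_apply_eq, Matrix.one_apply_eq]; rfl
  · rw [Matrix.one_apply_ne h, Matrix.one_apply_ne h]; rfl

/-- **`|(k_ij − δ_ij)(w)|_w = |E₃(k)_ij − δ_ij|_w`** — the two level texts agree entry by entry. [cite: Rogawski1990, §12.7 Lemma 12.7.3 (proof) p. 195] -/
theorem valued_sub_one_apply_eq (k : ↥(unitaryGroupOfForm (conjLocal L (IsCMField.complexConj L) v) (cmLocalForm L 3 v))) (i j : Fin 3) :
    Valued.v ((((k : GL (Fin 3) (LocalRing L v)).val i j - (1 : Matrix (Fin 3) (Fin 3) (LocalRing L v)) i j) : LocalRing L v) w) =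
      Valued.v ((((localNonsplitEquiv (IsCMField.complexConj L) (qsForm L) (IsCMField.complexConj_ne_one L) w hw k :
          ↥(unitaryGroupOfForm (galAdicCompletionMap (L := L) (IsCMField.complexConj L) hw) (placeForm (qsForm L) w.1))) :
          GL (Fin 3) (w.1.adicCompletion L)) : Matrix (Fin 3) (Fin 3) (w.1.adicCompletion L)) i j - (1 : Matrix (Fin 3) (Fin 3) (w.1.adicCompletion L)) i j) := by
  rw [coe_localNonsplitEquiv_apply_apply, ← one_apply_apply L v w i j]
  rfl

/-- **`hKr ⟸ hK`**: the `E₃`-coordinate level text (★ p849833 ∕ ★ p849876 `hK`, ★ G-SHELL-DATA) gives the `LocalRing`-at-`w` level text (★ p850004 `hKr`) — `exact`-able.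
[cite: Rogawski1990, §12.7 Lemma 12.7.3 (proof) p. 195] -/
theorem hKr_of_hK (K : Subgroup ↥(unitaryGroupOfForm (conjLocal L (IsCMField.complexConj L) v) (cmLocalForm L 3 v))) {r : WithZero (Multiplicative ℤ)}
    (hK : ∀ k ∈ K, ∀ i j : Fin 3, Valued.v ((((localNonsplitEquiv (IsCMField.complexConj L) (qsForm L) (IsCMField.complexConj_ne_one L) w hw k :
        ↥(unitaryGroupOfForm (galAdicCompletionMap (L := L) (IsCMField.complexConj L) hw) (placeForm (qsForm L) w.1))) :
        GL (Fin 3) (w.1.adicCompletion L)) : Matrix (Fin 3) (Fin 3) (w.1.adicCompletion L)) i j - (1 : Matrix (Fin 3) (Fin 3) (w.1.adicCompletion L)) i j) ≤ r) :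
    ∀ k ∈ K, ∀ i j : Fin 3, Valued.v ((((k : GL (Fin 3) (LocalRing L v)).val i j - (1 : Matrix (Fin 3) (Fin 3) (LocalRing L v)) i j) : LocalRing L v) w) ≤ r :=
  fun k hk i j => by rw [valued_sub_one_apply_eq L v w hw]; exact hK k hk i j

/-- **`hK ⟸ hKr`**: the converse bridge. [cite: Rogawski1990, §12.7 Lemma 12.7.3 (proof) p. 195] -/
theorem hK_of_hKr (K : Subgroup ↥(unitaryGroupOfForm (conjLocal L (IsCMField.complexConj L) v) (cmLocalForm L 3 v))) {r : WithZero (Multiplicative ℤ)}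
    (hKr : ∀ k ∈ K, ∀ i j : Fin 3, Valued.v ((((k : GL (Fin 3) (LocalRing L v)).val i j - (1 : Matrix (Fin 3) (Fin 3) (LocalRing L v)) i j) : LocalRing L v) w) ≤ r) :
    ∀ k ∈ K, ∀ i j : Fin 3, Valued.v ((((localNonsplitEquiv (IsCMField.complexConj L) (qsForm L) (IsCMField.complexConj_ne_one L) w hw k :
        ↥(unitaryGroupOfForm (galAdicCompletionMap (L := L) (IsCMField.complexConj L) hw) (placeForm (qsForm L) w.1))) :
        GL (Fin 3) (w.1.adicCompletion L)) : Matrix (Fin 3) (Fin 3) (w.1.adicCompletion L)) i j - (1 : Matrix (Fin 3) (Fin 3) (w.1.adicCompletion L)) i j) ≤ r :=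
  fun k hk i j => by rw [← valued_sub_one_apply_eq L v w hw]; exact hKr k hk i j

/-! ## §2 The diagonal reading of the shell point `b = z·𝓘.aᵐ` -/

/-- If `b = diag(d)` in `GL₃(∏ L_{w′})` and `E₃ b = diag(e)`, then `d_i(w) = e_i`. [cite: PlatonovRapinchuk1994, §5.1] -/
theorem apply_eq_of_glDiagonal_eq {b : ↥(unitaryGroupOfForm (conjLocal L (IsCMField.complexConj L) v) (cmLocalForm L 3 v))} {d : Fin 3 → (LocalRing L v)ˣ}
    (hd : glDiagonal 3 (LocalRing L v) d = (b : GL (Fin 3) (LocalRing L v))) {e : Fin 3 → w.1.adicCompletion L}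
    (hb : (((localNonsplitEquiv (IsCMField.complexConj L) (qsForm L) (IsCMField.complexConj_ne_one L) w hw b :
        ↥(unitaryGroupOfForm (galAdicCompletionMap (L := L) (IsCMField.complexConj L) hw) (placeForm (qsForm L) w.1))) :
        GL (Fin 3) (w.1.adicCompletion L)) : Matrix (Fin 3) (Fin 3) (w.1.adicCompletion L)) = Matrix.diagonal e) (i : Fin 3) :
    ((d i : (LocalRing L v)ˣ) : LocalRing L v) w = e i := by
  have h := congrFun (congrFun hb i) i
  rw [Matrix.diagonal_apply_eq, coe_localNonsplitEquiv_apply_apply, ← hd, coe_glDiagonal, Matrix.diagonal_apply_eq] at h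
  exact h

/-- **`E₃(z·aᵐ) = diag(βαᵐ, β, β(σ_w α)^{−m})`** for `E₃ z = β·1`, `E₃ a = diag(α, 1, (σ_w α)⁻¹)` (★ `coe_central_mul_pow_eq_diagonal` at the model `E₃`).
[cite: Rogawski1990, §12.7 Lemma 12.7.3 (proof) p. 195] -/
theorem coe_localNonsplitEquiv_central_mul_pow {z a : ↥(unitaryGroupOfForm (conjLocal L (IsCMField.complexConj L) v) (cmLocalForm L 3 v))} {β α : w.1.adicCompletion L}
    (hz : (((localNonsplitEquiv (IsCMField.complexConj L) (qsForm L) (IsCMField.complexConj_ne_one L) w hw z :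
        ↥(unitaryGroupOfForm (galAdicCompletionMap (L := L) (IsCMField.complexConj L) hw) (placeForm (qsForm L) w.1))) :
        GL (Fin 3) (w.1.adicCompletion L)) : Matrix (Fin 3) (Fin 3) (w.1.adicCompletion L)) = β • (1 : Matrix (Fin 3) (Fin 3) (w.1.adicCompletion L)))
    (ha : (((localNonsplitEquiv (IsCMField.complexConj L) (qsForm L) (IsCMField.complexConj_ne_one L) w hw a :
        ↥(unitaryGroupOfForm (galAdicCompletionMap (L := L) (IsCMField.complexConj L) hw) (placeForm (qsForm L) w.1))) :
        GL (Fin 3) (w.1.adicCompletion L)) : Matrix (Fin 3) (Fin 3) (w.1.adicCompletion L)) =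
        Matrix.diagonal ![α, 1, ((galAdicCompletionMap (L := L) (IsCMField.complexConj L) hw) α)⁻¹]) (m : ℕ) :
    (((localNonsplitEquiv (IsCMField.complexConj L) (qsForm L) (IsCMField.complexConj_ne_one L) w hw (z * a ^ m) :
        ↥(unitaryGroupOfForm (galAdicCompletionMap (L := L) (IsCMField.complexConj L) hw) (placeForm (qsForm L) w.1))) :
        GL (Fin 3) (w.1.adicCompletion L)) : Matrix (Fin 3) (Fin 3) (w.1.adicCompletion L)) =
      Matrix.diagonal ![β * α ^ m, β, β * (((galAdicCompletionMap (L := L) (IsCMField.complexConj L) hw) α)⁻¹) ^ m] := by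
  have h := F0P3cStCharTSShellPatternHom.coe_central_mul_pow_eq_diagonal
    ((unitaryGroupOfForm (galAdicCompletionMap (L := L) (IsCMField.complexConj L) hw) (placeForm (qsForm L) w.1)).subtype.comp
      (localNonsplitEquiv (IsCMField.complexConj L) (qsForm L) (IsCMField.complexConj_ne_one L) w hw).toMonoidHom) hz ha m
  refine h.trans (congrArg Matrix.diagonal (funext fun i => ?_))
  fin_cases i
  · rfl
  · simp only [Fin.mk_one, Matrix.cons_val_one, Matrix.cons_val_zero, one_pow, mul_one]
  · rfl

/-- **The diagonal reading `hd ∕ h01 ∕ h12` of the shell point** (binders of ★ p850004 «OCAN-SHELL»): for `b = z·aᵐ ∈ M` with `E₃ z = β·1`, `|β|_w = 1`,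
`E₃ a = diag(α, 1, (σ_w α)⁻¹)`, `0 < |α|_w < 1`, `m ≥ 1`: `∃ d`, `glDiagonal 3 (∏ L_{w′}) d = ↑b`, `d₀(w) = βαᵐ`, `d₁(w) = β`, `d₂(w) = β(σ_w α)^{−m}`,
`|d₀(w)| < |d₁(w)| < |d₂(w)|`. [cite: Rogawski1990, §12.7 Lemma 12.7.3 (proof) p. 195; §4.9 p. 55] -/
theorem exists_glDiagonal_shellPoint {z a : ↥(unitaryGroupOfForm (conjLocal L (IsCMField.complexConj L) v) (cmLocalForm L 3 v))} {β α : w.1.adicCompletion L}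
    (hz : (((localNonsplitEquiv (IsCMField.complexConj L) (qsForm L) (IsCMField.complexConj_ne_one L) w hw z :
        ↥(unitaryGroupOfForm (galAdicCompletionMap (L := L) (IsCMField.complexConj L) hw) (placeForm (qsForm L) w.1))) :
        GL (Fin 3) (w.1.adicCompletion L)) : Matrix (Fin 3) (Fin 3) (w.1.adicCompletion L)) = β • (1 : Matrix (Fin 3) (Fin 3) (w.1.adicCompletion L)))
    (hβ : Valued.v β = 1)
    (ha : (((localNonsplitEquiv (IsCMField.complexConj L) (qsForm L) (IsCMField.complexConj_ne_one L) w hw a :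
        ↥(unitaryGroupOfForm (galAdicCompletionMap (L := L) (IsCMField.complexConj L) hw) (placeForm (qsForm L) w.1))) :
        GL (Fin 3) (w.1.adicCompletion L)) : Matrix (Fin 3) (Fin 3) (w.1.adicCompletion L)) =
        Matrix.diagonal ![α, 1, ((galAdicCompletionMap (L := L) (IsCMField.complexConj L) hw) α)⁻¹])
    (hα0 : α ≠ 0) (hα1 : Valued.v α < 1) {m : ℕ} (hm : 1 ≤ m) (hbM : z * a ^ m ∈ (cmBorelTriple L 3 v).M) :
    ∃ d : Fin 3 → (LocalRing L v)ˣ, glDiagonal 3 (LocalRing L v) d = ((z * a ^ m : ↥(unitaryGroupOfForm (conjLocal L (IsCMField.complexConj L) v) (cmLocalForm L 3 v))) :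
        GL (Fin 3) (LocalRing L v)) ∧
      ((d 0 : (LocalRing L v)ˣ) : LocalRing L v) w = β * α ^ m ∧ ((d 1 : (LocalRing L v)ˣ) : LocalRing L v) w = β ∧
      ((d 2 : (LocalRing L v)ˣ) : LocalRing L v) w = β * (((galAdicCompletionMap (L := L) (IsCMField.complexConj L) hw) α)⁻¹) ^ m ∧
      Valued.v (((d 0 : (LocalRing L v)ˣ) : LocalRing L v) w) < Valued.v (((d 1 : (LocalRing L v)ˣ) : LocalRing L v) w) ∧
      Valued.v (((d 1 : (LocalRing L v)ˣ) : LocalRing L v) w) < Valued.v (((d 2 : (LocalRing L v)ˣ) : LocalRing L v) w) := by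
  obtain ⟨d, hd⟩ := (mem_torusU_iff _).1 hbM
  have hdiag := coe_localNonsplitEquiv_central_mul_pow L v w hw hz ha m
  have h0 := apply_eq_of_glDiagonal_eq L v w hw hd hdiag 0
  have h1 := apply_eq_of_glDiagonal_eq L v w hw hd hdiag 1
  have h2 := apply_eq_of_glDiagonal_eq L v w hw hd hdiag 2
  simp only [Matrix.cons_val_zero, Matrix.cons_val_one, Matrix.cons_val_two, Matrix.head_cons, Matrix.tail_cons] at h0 h1 h2
  have hm0 : m ≠ 0 := by omega
  have hvα : 0 < Valued.v α := (Valuation.pos_iff _).2 hα0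
  refine ⟨d, hd, h0, h1, h2, ?_, ?_⟩
  · rw [h0, h1, map_mul, map_pow, hβ, one_mul]
    exact pow_lt_one₀ zero_le hα1 hm0
  · rw [h1, h2, map_mul, map_pow, map_inv₀, valued_galAdicCompletionMap, hβ, one_mul]
    exact one_lt_pow₀ ((one_lt_inv₀ hvα).2 hα1) hm0

end Summit.HodgeConjecture.HodgeConjecture.Cruxes.H413.F0P3cStCharTSHKSpellings

end
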